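import Summits.FinalStateConjecture.FinalStateConjecture.Statement
import Literature.Geometry.Lorentzian.KerrConvergenceNonempty
import Literature.Geometry.Lorentzian.KissingBallsCutMass
import Literature.Geometry.Lorentzian.LeafAdaptedModelChartsMinkowski
import Literature.Geometry.Lorentzian.CompleteDevelopmentMaximal

/-!
# Solo (blind) — rung 0 of the final state conjecture: Minkowski space settles (N = 0)

The conclusion of the summit `FinalStateConjecture` is verified, clause by clause, at the trivial
final state: Minkowski space `(ℝ⁴, η, ∂ₜ)` as the vacuum Cauchy development
`Minkowski.vacuumCauchyDevelopment` of the trivial datum `(ℝ³, δ, 0)`, with the settled region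
`O = J⁺(Σ) = {x⁰ ≥ 0}` and the trivial decomposition `Minkowski.finalStateDecomposition 2 0`
(`N = 0`, identity flat chart after `τ₀ = 0`):

* `soloBlind_causalFuture_range_embed` — `J⁺({x⁰ = 0}) = {x⁰ ≥ 0}`;
  `soloBlind_chronologicalPast_lateRegion` — `I⁻({x⁰ > 0}) = E4`; hence
  `soloBlind_exteriorOf` — the exterior `J⁺(Σ) ∩ I⁻(charted)` of the statement IS `{x⁰ ≥ 0}`;
* `soloBlind_raysStayInClosure` — every future-complete normalised null ray from `Σ` is a
  straight null line `(t, p + t e)` (uniqueness of geodesics) and stays in `{x⁰ ≥ 0}`;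
* `soloBlind_hasExhaustiveCharts` — the exhaustion clause: `{0 ≤ x⁰ ≤ τ₁} ⊆ J⁻({x⁰ = τ₁})`;
* `soloBlind_isFutureOriented` — `dι(∂₀) = ∂₀` is future-directed;
* `soloBlind_minkowski_conclusion` — all clauses of the summit's conclusion, including complete
  future null infinity (`Minkowski.hasCompleteFutureNullInfinity_vacuumCauchyDevelopment`), hold
  for the Minkowski development;
* `soloBlind_exists_isMaximal_and_conclusion` — given the Choquet-Bruhat–Geroch existence
  theorem (named fact `choquetBruhat_geroch_exists_mghd_cauchy`), the trivial datum has a maximal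
  development satisfying every clause of the conclusion (Minkowski space itself,
  `Minkowski.isMaximal_vacuumCauchyDevelopment_iff`).

Role. This is the `N = 0`, `D = (ℝ³, δ, 0)` instance of the pointwise final-state property whose
genericity the summit asserts (the base of the ladder
trivial datum → small data (Christodoulou–Klainerman 1993) → near-Kerr data (Hintz 2026,
arXiv:2606.28253) → large data), and the satisfiability certificate of the typed conclusion: its
eight clauses (`HasCompleteNullInfinity`, subextremality, `O = exteriorOf`, `RaysStayInClosure`,
`HasExhaustiveCharts` (i)–(iii), `IsFutureOriented` (i)–(iii)) are jointly satisfiable against an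
honest causal structure. What is NOT proved here: the transport of the conclusion to an arbitrary
maximal development of the trivial datum along the isometry
`Minkowski.isIsometricTo_vacuumCauchyDevelopment_of_isMaximal` (isometry-invariance of each
clause).

References: D. Christodoulou, S. Klainerman, *The global nonlinear stability of the Minkowski
space*, Princeton 1993, Thm. 1.0.3 (p. 20); B. O'Neill, *Semi-Riemannian geometry*, 1983, Ch. 14,
p. 402 (causality of `ℝ⁴₁`), Ch. 3, Ex. 3.25 (geodesics of `ℝⁿ_ν`); D. Christodoulou, CQG 16
(1999) A23, pp. A26–A27 (normalised null rays, complete `𝓘⁺`).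
-/

noncomputable section

open Literature.Geometry.Lorentzian TopologicalSpace Manifold Filter Topology Set Function
open scoped ContDiff Topology ENNReal

namespace Summit.FinalStateConjecture.FinalStateConjecture.Theorems

open Minkowski

/-- The settled region of Minkowski space: the closed future half-space `{x⁰ ≥ 0} = J⁺({x⁰ = 0})`.
O'Neill 1983, Ch. 14, p. 402. -/
def soloBlindHalfSpace : Set E4 := {x | 0 ≤ x 0}

/-- Membership in the half-space `{x⁰ ≥ 0}` (unfolding lemma). -/
theorem soloBlind_mem_halfSpace {x : E4} : x ∈ soloBlindHalfSpace ↔ 0 ≤ x 0 := Iff.rfl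

/-- The half-space is closed. -/
theorem soloBlind_isClosed_halfSpace : IsClosed soloBlindHalfSpace :=
  isClosed_le continuous_const ((EuclideanSpace.proj (0 : Fin 4)).continuous)

/-- The late region `{x⁰ > 0}` lies in the half-space `{x⁰ ≥ 0}`. -/
theorem soloBlind_lateRegion_subset : Minkowski.lateRegion 0 ⊆ soloBlindHalfSpace :=
  fun x (hx : 0 < x 0) ↦ show 0 ≤ x 0 from le_of_lt hx

/-- **`J⁺(Σ) = {x⁰ ≥ 0}`** for the slice `Σ = {x⁰ = 0}` of the Minkowski development (solid cone
description of `J⁺` of a point, O'Neill 1983, Ch. 14, p. 402). -/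
theorem soloBlind_causalFuture_range_embed :
    (vacuumCauchyDevelopment.metric.causalFuture vacuumCauchyDevelopment.timeOrientation
      (range vacuumCauchyDevelopment.embed) : Set E4) = soloBlindHalfSpace := by
  ext q
  constructor
  · intro hq
    rw [LorentzianMetric.causalFuture_eq_biUnion] at hq
    obtain ⟨p, hp, hqp⟩ := mem_iUnion₂.1 hq
    obtain ⟨y, rfl⟩ := hp
    have h := (Set.ext_iff.mp (Minkowski.causalFuture_singleton (sliceEmbed y)) q).mp hqp
    have h0 : (sliceEmbed y : E4) 0 = 0 := E4.ofTimeSpace_apply_zero 0 _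
    rw [mem_setOf_eq, h0, sub_zero] at h
    exact (norm_nonneg _).trans h
  · intro hq
    have hq' : q ∈ vacuumCauchyDevelopment.metric.causalFuture vacuumCauchyDevelopment.timeOrientation
        ({E4.ofTimeSpace 0 (E4.spatial q)} : Set E4) :=
      mem_causalFuture_vacuumCauchyDevelopment (by
        rw [E4.spatial_ofTimeSpace, sub_self, norm_zero, E4.ofTimeSpace_apply_zero, sub_zero]
        exact hq)
    have hmem : E4.ofTimeSpace 0 (E4.spatial q) ∈ range vacuumCauchyDevelopment.embed :=
      ⟨⟨E4.spatial q, mem_slice _⟩, rfl⟩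
    exact LorentzianMetric.causalFuture_mono (g := vacuumCauchyDevelopment.metric)
      (singleton_subset_iff.2 hmem) hq'

/-- **`I⁻({x⁰ > τ₀}) = E4`**: every event of Minkowski space is chronologically earlier than the
late half-space (vertical timelike segments, O'Neill 1983, Ch. 14, p. 402). -/
theorem soloBlind_chronologicalPast_lateRegion (τ₀ : ℝ) :
    (vacuumCauchyDevelopment.metric.chronologicalPast vacuumCauchyDevelopment.timeOrientation
      (Minkowski.lateRegion τ₀) : Set E4) = univ := by
  refine eq_univ_of_forall fun x ↦ ?_
  change E4 at x
  set k : E4 := E4.ofTimeSpace (max (x 0) τ₀ + 1) (E4.spatial x) with hk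
  have hk0 : k 0 = max (x 0) τ₀ + 1 := E4.ofTimeSpace_apply_zero _ _
  have hklate : k ∈ Minkowski.lateRegion τ₀ := by
    show τ₀ < k 0
    rw [hk0]
    linarith [le_max_right (x 0) τ₀]
  have hxk : x ∈ (vacuumCauchyDevelopment.metric.chronologicalPast
      vacuumCauchyDevelopment.timeOrientation {k} : Set E4) :=
    LorentzianMetric.mem_chronologicalPast_of_mem_chronologicalFuture
      (g := vacuumCauchyDevelopment.metric)
      (mem_chronologicalFuture_of_spatial_eq (by rw [hk, E4.spatial_ofTimeSpace])
        (by rw [hk0]; linarith [le_max_left (x 0) τ₀]))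
  exact LorentzianMetric.chronologicalFuture_mono (g := vacuumCauchyDevelopment.metric)
    (singleton_subset_iff.2 hklate) hxk

/-- **The exterior of the statement at the trivial decomposition is `{x⁰ ≥ 0}`**:
`J⁺(Σ) ∩ I⁻(charted) = {x⁰ ≥ 0} ∩ E4`. -/
theorem soloBlind_exteriorOf :
    soloBlindHalfSpace =
      Summit.FinalStateConjecture.exteriorOf vacuumCauchyDevelopment.toCauchyDevelopment
        (Minkowski.finalStateDecomposition 2 0 soloBlind_lateRegion_subset).charted := by
  rw [Minkowski.charted_finalStateDecomposition]
  change soloBlindHalfSpace =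
    (vacuumCauchyDevelopment.metric.causalFuture vacuumCauchyDevelopment.timeOrientation
      (range vacuumCauchyDevelopment.embed) : Set E4) ∩
      vacuumCauchyDevelopment.metric.chronologicalPast vacuumCauchyDevelopment.timeOrientation
        (Minkowski.lateRegion 0)
  rw [soloBlind_causalFuture_range_embed, soloBlind_chronologicalPast_lateRegion]
  exact (inter_univ _).symm

/-- **Rays stay in the closure of the exterior**: a maximal future null geodesic of `η` from a
slice point `(0, p)`, normalised by `η(γ'(0), ∂ₜ) = -1`, is the straight line
`t ↦ (0, p) + t L` with `L⁰ = 1` (uniqueness of geodesics, O'Neill 1983, Ch. 3, Ex. 3.25 and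
Lemma 3.22), so `(γ t)⁰ = t ≥ 0` for `t ≥ 0`. Christodoulou, CQG 16 (1999), p. A26. -/
theorem soloBlind_raysStayInClosure :
    Summit.FinalStateConjecture.RaysStayInClosure vacuumCauchyDevelopment.toCauchyDevelopment
      soloBlindHalfSpace := by
  intro inst p γ dom hray _ t ht ht0
  change ℝ → E4 at γ
  haveI : Minkowski.smoothMetric.toPseudoRiemannianMetric.HasLeviCivita := inst
  obtain ⟨hmax, h0, hγ0, -, -, hnorm⟩ := hray
  apply subset_closure
  set v : E4 := velocity 𝓘(ℝ, E4) γ 0 with hv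
  have hline : IsGeodesic Minkowski.smoothMetric.toPseudoRiemannianMetric.leviCivita
      (fun s : ℝ ↦ γ 0 + s • v) :=
    ModelSpace.isGeodesic_line smoothMetric_val (γ 0) v
  have hγgeo : IsGeodesicOn Minkowski.smoothMetric.toPseudoRiemannianMetric.leviCivita γ dom :=
    hmax.2.2.1
  have heq : EqOn γ (fun s : ℝ ↦ γ 0 + s • v) dom :=
    PseudoRiemannianMetric.eqOn_of_isGeodesicOn
      (g := Minkowski.smoothMetric.toPseudoRiemannianMetric) hmax.1 hmax.2.1 hγgeo
      (hline.mono (subset_univ _)) h0 (by simp) (by rw [ModelSpace.velocity_line])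
  have hnorm' : Minkowski.bilin v (E4.basisVector 0) = -1 := hnorm
  have hv0 : v 0 = 1 := by
    rw [Minkowski.bilin_symm, Minkowski.bilin_basisVector_zero_left] at hnorm'
    linarith
  have hγ00 : γ 0 0 = 0 := by
    have : γ 0 = E4.ofTimeSpace 0 (p : E3) := hγ0
    rw [this]
    exact E4.ofTimeSpace_apply_zero 0 _
  show 0 ≤ γ t 0
  rw [heq ht]
  simp only [PiLp.add_apply, PiLp.smul_apply, smul_eq_mul, hγ00, hv0, mul_one, zero_add]
  exact ht0

/-- **The charts exhaust the exterior** for the trivial decomposition: no hole charts, and for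
every `τ₁ > 0` the part `{0 ≤ x⁰ ≤ τ₁}` of the exterior not yet in `{x⁰ > τ₁}` lies in the causal
past of the flat slab `{x⁰ = τ₁}` (vertical segment; O'Neill 1983, Ch. 14, p. 402). -/
theorem soloBlind_hasExhaustiveCharts :
    Summit.FinalStateConjecture.HasExhaustiveCharts
      (Minkowski.finalStateDecomposition 2 0 soloBlind_lateRegion_subset) := by
  haveI : IsEmpty (Fin (Minkowski.finalStateDecomposition 2 0 soloBlind_lateRegion_subset).N) :=
    Fin.isEmpty'
  refine ⟨fun i ↦ i.elim0, fun i ↦ i.elim0, fun i ↦ i.elim0, fun τ₁ _ x hx ↦ ?_⟩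
  obtain ⟨hxO, hxlate⟩ := hx
  rw [Summit.FinalStateConjecture.certifiedLate, iUnion_of_empty, union_empty] at hxlate
  rw [Summit.FinalStateConjecture.certifiedSlab, iUnion_of_empty, union_empty]
  change E4 at x
  have hx0 : 0 ≤ x 0 := hxO
  have hx1 : ¬ τ₁ < x 0 := fun h ↦ hxlate ⟨⟨x, trivial⟩, h, rfl⟩
  have hq : x ∈ vacuumCauchyDevelopment.metric.causalPast vacuumCauchyDevelopment.timeOrientation
      ({E4.ofTimeSpace τ₁ (E4.spatial x)} : Set E4) :=
    mem_causalPast_vacuumCauchyDevelopment (by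
      rw [E4.spatial_ofTimeSpace, sub_self, norm_zero, E4.ofTimeSpace_apply_zero]
      linarith [not_lt.1 hx1])
  refine LorentzianMetric.causalFuture_mono (singleton_subset_iff.2 ?_) hq
  exact ⟨⟨E4.ofTimeSpace τ₁ (E4.spatial x), trivial⟩, E4.ofTimeSpace_apply_zero τ₁ (E4.spatial x),
    rfl⟩

/-- **The trivial decomposition is future-oriented**: no hole charts, and the flat chart is the
inclusion `ι` of the open submanifold `⊤ ⊆ E4`, so `dι(∂₀) = ∂₀`, which is future-directed
timelike for `(η, ∂ₜ)` (O'Neill 1983, Ch. 5, p. 145). -/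
theorem soloBlind_isFutureOriented :
    Summit.FinalStateConjecture.IsFutureOriented
      (Minkowski.finalStateDecomposition 2 0 soloBlind_lateRegion_subset) := by
  refine ⟨fun i ↦ i.elim0, fun i ↦ i.elim0, Filter.Eventually.of_forall fun τ x _ ↦ ?_⟩
  change vacuumCauchyDevelopment.toSpacetime.timeOrientation.IsFutureDirected
    (mfderiv 𝓘(ℝ, E4) 𝓘(ℝ, E4) (Subtype.val : (⊤ : Opens E4) → E4) x (E4.basisVector 0))
  rw [OpensChart.mfderiv_subtypeVal_apply]
  change (Minkowski.bilin (E4.basisVector 0) (E4.basisVector 0) ≤ 0 ∧ E4.basisVector 0 ≠ 0) ∧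
    Minkowski.bilin (E4.basisVector 0) (E4.basisVector 0) < 0
  rw [Minkowski.bilin_basisVector_zero]
  refine ⟨⟨by norm_num, fun h ↦ ?_⟩, by norm_num⟩
  have := congrArg (fun w : E4 ↦ w 0) h
  simp at this

/-- **Rung 0: every clause of the conclusion of the final state conjecture holds for the Minkowski
development of the trivial datum** — complete future null infinity, and the trivial (`N = 0`)
final state on the exterior `{x⁰ ≥ 0} = J⁺(Σ) ∩ I⁻(charted)`, with the rays, exhaustion and
orientation clauses. Christodoulou–Klainerman 1993, Thm. 1.0.3 (trivial case); Christodoulou,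
CQG 16 (1999), p. A27. -/
theorem soloBlind_minkowski_conclusion :
    Summit.FinalStateConjecture.HasCompleteNullInfinity vacuumCauchyDevelopment.toCauchyDevelopment ∧
      ∃ (O : Set vacuumCauchyDevelopment.carrier)
        (d : FinalStateDecomposition vacuumCauchyDevelopment.toSpacetime O 2),
        (∀ i, Kerr.IsSubextremal (d.mass i) (d.spin i)) ∧
          O = Summit.FinalStateConjecture.exteriorOf vacuumCauchyDevelopment.toCauchyDevelopment
            d.charted ∧
            Summit.FinalStateConjecture.RaysStayInClosure
              vacuumCauchyDevelopment.toCauchyDevelopment O ∧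
              Summit.FinalStateConjecture.HasExhaustiveCharts d ∧
                Summit.FinalStateConjecture.IsFutureOriented d :=
  ⟨fun {_} ↦ hasCompleteFutureNullInfinity_vacuumCauchyDevelopment, soloBlindHalfSpace,
    Minkowski.finalStateDecomposition 2 0 soloBlind_lateRegion_subset, fun i ↦ i.elim0,
    soloBlind_exteriorOf, soloBlind_raysStayInClosure, soloBlind_hasExhaustiveCharts,
    soloBlind_isFutureOriented⟩

/-- **Given the Choquet-Bruhat–Geroch existence theorem, the trivial datum has a maximal
development satisfying every clause of the conclusion** (Minkowski space is then itself maximal,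
`Minkowski.isMaximal_vacuumCauchyDevelopment_iff`; the universal quantification over ALL maximal
developments additionally needs isometry-transport of the clauses, not done here).
Choquet-Bruhat–Geroch, CMP 14 (1969), Thm. 3; Ringström 2009, Thm. 16.6. -/
theorem soloBlind_exists_isMaximal_and_conclusion
    (hcbg : choquetBruhat_geroch_exists_mghd_cauchy) :
    ∃ 𝒟 : VacuumCauchyDevelopment trivialData, 𝒟.IsMaximal ∧
      Summit.FinalStateConjecture.HasCompleteNullInfinity 𝒟.toCauchyDevelopment ∧
        ∃ (O : Set 𝒟.carrier) (d : FinalStateDecomposition 𝒟.toSpacetime O 2),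
          (∀ i, Kerr.IsSubextremal (d.mass i) (d.spin i)) ∧
            O = Summit.FinalStateConjecture.exteriorOf 𝒟.toCauchyDevelopment d.charted ∧
              Summit.FinalStateConjecture.RaysStayInClosure 𝒟.toCauchyDevelopment O ∧
                Summit.FinalStateConjecture.HasExhaustiveCharts d ∧
                  Summit.FinalStateConjecture.IsFutureOriented d :=
  ⟨vacuumCauchyDevelopment,
    Minkowski.isMaximal_vacuumCauchyDevelopment_iff.2
      (hcbg.exists_isMaximal_of_mem_admissibleVacuumData trivialData_mem_admissibleVacuumData),
    soloBlind_minkowski_conclusion⟩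

end Summit.FinalStateConjecture.FinalStateConjecture.Theorems

end
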